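import Mathlib
import Summits.Ventures.PercRepro.PuncturedLYMCapGuard
import Summits.Ventures.PercRepro.PuncturedLYMCapTriplesPoly

/-!
# PercRepro — THE VALUE-BLOCK PIPELINE AT (3,3), UNIFORMLY IN `(n, k)`: (SP) FOR EVERY FAMILY OF DISJOINT TRIPLES
(p10, gen 43)

The first DEPTH-2 certificate produced by the pipeline: `k` pairwise disjoint triples at level `3` on `n = 3k + f`
points.  The β-table `tab` dispatches on the stage `(w, l)`: the cap-`2` stage (`β₂(1) = B`, `β₂(2) = 1`), the cap-`1`
stage at level `3` (`β₁(1) = x₁`, `β₁(2) = x₂`, `β₁(3) = x₃`, `β₁(4) = 1`) and the cap-`1` stage at level `1` (`β₁(1) = y₁`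
written at the top count `K + 1`, `β₁(2) = 1`); the entries are the reduced rational functions of
`PuncturedLYMCapTriplesPoly` (`0` at `K = 0`, where no entry matters).  `tab_mem` is their membership in `[0, 1]`
(the shift lemmas, region by region, the four boundary points by `norm_num`), `countOKg_tab` the guarded
admissibility: the six leaf identities (classes `0 … 3` of the level-`3` stage, classes `0, 1` of the level-`1` stage)
are `field_simp; ring` on the reduced forms, their boundary cases `norm_num`.  `puncturedNMP_triples33`: (SP) for
every family of pairwise disjoint triples at level `3`, by `puncturedNMP_of_countOKg`.  Nothing here asserts (SP).
-/

namespace PercRepro.PuncturedLYM.Split.Peel.Cap33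

open Finset PercRepro.PuncturedLYM.Split.Peel

/-- The forced entries: `1` on the all-block columns (`w·c = l + 1`), `0` elsewhere. -/
def forced (l w c : ℕ) : ℚ := if w * c = l + 1 then 1 else 0

/-- The β-table of the pattern (triples at level `3`), dispatching on the stage `(w, l)`; `K` is the stage's own
count (the level-`1` stage is reached from the top count `K + 1`). -/
def tab : ℕ → ℕ → ℕ → ℕ → ℚ → ℚ → ℕ → ℚ := fun K f l w _ _ c =>
  if K = 0 then forced l w c
  else if w = 2 ∧ l = 3 then (if c = 1 then Bnum K f / Bden K f else forced l w c)
  else if w = 1 ∧ l = 3 then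
    (if c = 1 then x1num K f / x1den K f else if c = 2 then x2num K f / Bden K f
      else if c = 3 then x3num K f / x3den K f else forced l w c)
  else if w = 1 ∧ l = 1 then
    (if c = 1 then y1num ((K : ℚ) + 1) f / y1den ((K : ℚ) + 1) f else forced l w c)
  else forced l w c

/-! ### Evaluation -/

/-- `forced` lies in `[0, 1]`. -/
theorem forced_mem (l w c : ℕ) : 0 ≤ forced l w c ∧ forced l w c ≤ 1 := by
  unfold forced; split_ifs <;> norm_num

/-- The table at `c = 0` is `0`. -/
theorem tab_zero (K f l w : ℕ) (a γ : ℚ) : tab K f l w a γ 0 = 0 := by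
  unfold tab forced; split_ifs <;> first | rfl | omega | simp_all

/-- The table at the all-block columns is `1`. -/
theorem tab_forced (K f l w : ℕ) (a γ : ℚ) (c : ℕ) (h : w * c = l + 1) : tab K f l w a γ c = 1 := by
  unfold tab forced
  split_ifs <;> first | rfl | omega | simp_all

/-- The top stage, class `1`. -/
theorem tab_top1 {K : ℕ} (hK : K ≠ 0) (f : ℕ) (a γ : ℚ) : tab K f 3 2 a γ 1 = Bnum K f / Bden K f := by
  simp [tab, hK]

/-- The top stage, class `2`. -/
theorem tab_top2 (K f : ℕ) (a γ : ℚ) : tab K f 3 2 a γ 2 = 1 := tab_forced K f 3 2 a γ 2 rfl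

/-- The level-`3` cap-`1` stage, class `1`. -/
theorem tab_A1 {K : ℕ} (hK : K ≠ 0) (f : ℕ) (a γ : ℚ) : tab K f 3 1 a γ 1 = x1num K f / x1den K f := by
  simp [tab, hK]

/-- The level-`3` cap-`1` stage, class `2`. -/
theorem tab_A2 {K : ℕ} (hK : K ≠ 0) (f : ℕ) (a γ : ℚ) : tab K f 3 1 a γ 2 = x2num K f / Bden K f := by
  simp [tab, hK]

/-- The level-`3` cap-`1` stage, class `3`. -/
theorem tab_A3 {K : ℕ} (hK : K ≠ 0) (f : ℕ) (a γ : ℚ) : tab K f 3 1 a γ 3 = x3num K f / x3den K f := by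
  simp [tab, hK]

/-- The level-`3` cap-`1` stage, class `4`. -/
theorem tab_A4 (K f : ℕ) (a γ : ℚ) : tab K f 3 1 a γ 4 = 1 := tab_forced K f 3 1 a γ 4 rfl

/-- The level-`1` cap-`1` stage, class `1`. -/
theorem tab_B1 {K : ℕ} (hK : K ≠ 0) (f : ℕ) (a γ : ℚ) :
    tab K f 1 1 a γ 1 = y1num ((K : ℚ) + 1) f / y1den ((K : ℚ) + 1) f := by
  simp [tab, hK]

/-- The level-`1` cap-`1` stage, class `2`. -/
theorem tab_B2 (K f : ℕ) (a γ : ℚ) : tab K f 1 1 a γ 2 = 1 := tab_forced K f 1 1 a γ 2 rfl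

/-- The table at `K = 0`. -/
theorem tab_K0 (f l w : ℕ) (a γ : ℚ) (c : ℕ) : tab 0 f l w a γ c = forced l w c := by
  simp [tab]

/-! ### Membership in `[0, 1]` -/

/-- A quotient of a nonnegative numerator by a larger nonnegative denominator lies in `[0, 1]`. -/
theorem div_mem {x y : ℚ} (hx : 0 ≤ x) (hy : 0 ≤ y) (hxy : x ≤ y) : 0 ≤ x / y ∧ x / y ≤ 1 :=
  ⟨div_nonneg hx hy, div_le_one_of_le₀ hxy hy⟩

/-- `B ∈ [0, 1]` for `K ≥ 1`. -/
theorem B_mem {K f : ℕ} (hK : 1 ≤ K) : 0 ≤ Bnum K f / Bden K f ∧ Bnum K f / Bden K f ≤ 1 := by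
  rcases Nat.lt_or_ge f 2 with hf | hf
  · rcases Nat.lt_or_ge K 2 with hK2 | hK2
    · obtain rfl : K = 1 := by omega
      interval_cases f <;> norm_num [Bden, P33, cols1, n33]
    · exact div_mem (Bnum_nonneg_B hK2) (Bden_nonneg_B hK2) (Bnum_le_Bden_B hK2)
  · exact div_mem (Bnum_nonneg_A hK hf) (Bden_pos_A hK hf).le (Bnum_le_Bden_A hK hf)

/-- `x₁ ∈ [0, 1]` for `K ≥ 1`. -/
theorem x1_mem {K f : ℕ} (hK : 1 ≤ K) : 0 ≤ x1num K f / x1den K f ∧ x1num K f / x1den K f ≤ 1 :=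
  div_mem (x1num_nonneg hK) (x1den_nonneg hK) (x1num_le_x1den hK)

/-- `x₂ ∈ [0, 1]` for `K ≥ 1`. -/
theorem x2_mem {K f : ℕ} (hK : 1 ≤ K) : 0 ≤ x2num K f / Bden K f ∧ x2num K f / Bden K f ≤ 1 := by
  rcases Nat.lt_or_ge f 2 with hf | hf
  · rcases Nat.lt_or_ge K 2 with hK2 | hK2
    · obtain rfl : K = 1 := by omega
      interval_cases f <;> norm_num [Bden, P33, cols1, n33]
    · exact div_mem (x2num_nonneg_B hK2) (Bden_nonneg_B hK2) (x2num_le_Bden_B hK2)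
  · exact div_mem (x2num_nonneg_A hK hf) (Bden_pos_A hK hf).le (x2num_le_Bden_A hK hf)

/-- `x₃ ∈ [0, 1]` for `K ≥ 1`. -/
theorem x3_mem {K f : ℕ} (hK : 1 ≤ K) : 0 ≤ x3num K f / x3den K f ∧ x3num K f / x3den K f ≤ 1 := by
  rcases Nat.lt_or_ge f 2 with hf | hf
  · rcases Nat.lt_or_ge K 3 with hK3 | hK3
    · interval_cases K <;> interval_cases f <;> norm_num [x3den, x3num, P33, cols1, n33]
    · refine div_mem (x3num_nonneg_B (by omega)) ?_ (x3num_le_x3den_C hK3)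
      rw [x3den_eq]; exact mul_nonneg (by norm_num) (Bden_pos_C hK3).le
  · refine div_mem (x3num_nonneg_A hK hf) ?_ (x3num_le_x3den_A hK hf)
    rw [x3den_eq]; exact mul_nonneg (by norm_num) (Bden_pos_A hK hf).le

/-- `y₁ ∈ [0, 1]` for `K ≥ 1` (the stage's own count). -/
theorem y1_mem {K f : ℕ} (hK : 1 ≤ K) :
    0 ≤ y1num ((K : ℚ) + 1) f / y1den ((K : ℚ) + 1) f ∧ y1num ((K : ℚ) + 1) f / y1den ((K : ℚ) + 1) f ≤ 1 :=
  div_mem (y1num_nonneg hK) (y1den_nonneg hK) (y1num_le_y1den hK)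

/-- **The table lies in `[0, 1]`.** -/
theorem tab_mem {K f l w : ℕ} {a γ : ℚ} (c : ℕ) : 0 ≤ tab K f l w a γ c ∧ tab K f l w a γ c ≤ 1 := by
  unfold tab
  split_ifs with hK
  · exact forced_mem _ _ _
  · exact B_mem (by omega)
  · exact forced_mem _ _ _
  · exact x1_mem (by omega)
  · exact x2_mem (by omega)
  · exact x3_mem (by omega)
  · exact forced_mem _ _ _
  · exact y1_mem (by omega)
  · exact forced_mem _ _ _
  · exact forced_mem _ _ _

/-! ### The guarded admissibility: the six leaf identities -/

/-- **The table is admissible for every `(K, f)`.** -/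
theorem countOKg_tab (K f : ℕ) :
    CountOKg 3 tab 2 K f 3 1 (1 / (3 : ℚ)) (Y33 K f / P33 K f) := by
  simp only [CountOKg]
  refine ⟨tab_zero _ _ _ _ _ _, fun c => tab_mem c, fun c hc => tab_forced _ _ _ _ _ _ c hc, ?_⟩
  intro c hcK hc hguard
  have hc' : c ≤ 1 := by omega
  interval_cases c
  · -- the class `0`: the level-`3` cap-`1` stage
    norm_num
    refine ⟨tab_zero _ _ _ _ _ _, fun c => tab_mem c, tab_A4 _ _ _ _, ?_⟩
    intro c₁ hcK₁ hc₁ hguard₁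
    interval_cases c₁
    · -- (L0): `R = (f − 3)/4 + 3·K·x₁`
      have hf : 3 ≤ f := by omega
      simp only [tab_zero]
      norm_num
      rw [Nat.cast_sub hf]
      rcases Nat.eq_zero_or_pos K with hK0 | hKpos
      · subst hK0
        simp only [tab_K0, forced]
        norm_num
        have hP : P33 0 f ≠ 0 := (P33_pos_zero hf).ne'
        field_simp
        simp only [Y33, P33, n33]; ring
      · have hK0 : K ≠ 0 := hKpos.ne'
        rw [tab_A1 hK0]
        have hP : P33 K f ≠ 0 := (P33_pos hKpos (by omega)).ne'
        have hx1 : x1den K f ≠ 0 := by simp only [x1den]; exact mul_ne_zero (by norm_num) hP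
        field_simp
        simp only [Y33, P33, x1den, x1num, n33]; ring
    · -- (L1): `R − B = (1 − x₁)(f − 2)/3 + (3/2)·x₂·(K − 1)`
      have hK : 1 ≤ K := hcK₁
      have hK0 : K ≠ 0 := by omega
      have hf : 2 ≤ f := by omega
      simp only [tab_zero]
      norm_num
      rw [tab_A1 hK0, tab_A2 hK0, tab_top1 hK0]
      rw [Nat.cast_sub hf, Nat.cast_sub hK]
      have hP : P33 K f ≠ 0 := (P33_pos hK (by omega)).ne'
      have hB : Bden K f ≠ 0 := (Bden_pos_A hK hf).ne'
      have hx1 : x1den K f ≠ 0 := by simp only [x1den]; exact mul_ne_zero (by norm_num) hP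
      field_simp
      simp only [Y33, P33, Bden, Bnum, x1den, x1num, x2num, cols1, n33]; ring
    · -- (L2): `R − 2B = (1 − x₂)(f − 1)/2 + x₃·(K − 2)`
      have hK : 2 ≤ K := hcK₁
      have hK0 : K ≠ 0 := by omega
      have hf : 1 ≤ f := by omega
      simp only [tab_zero]
      norm_num
      rw [tab_A2 hK0, tab_A3 hK0, tab_top1 hK0]
      rw [Nat.cast_sub hf, Nat.cast_sub hK]
      have hP : P33 K f ≠ 0 := (P33_pos_two hK).ne'
      have hB : Bden K f ≠ 0 := (Bden_pos_B hK hf).ne'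
      have hx3 : x3den K f ≠ 0 := by rw [x3den_eq]; exact mul_ne_zero (by norm_num) hB
      field_simp
      simp only [Y33, P33, Bden, Bnum, x2num, x3num, x3den, cols1, n33]; ring
    · -- (L3): `R − 3B = (1 − x₃)·f + (3/4)(K − 3)`
      have hK : 3 ≤ K := hcK₁
      have hK0 : K ≠ 0 := by omega
      simp only [tab_zero]
      norm_num
      rw [tab_A4, tab_A3 hK0, tab_top1 hK0]
      rw [Nat.cast_sub hK]
      have hP : P33 K f ≠ 0 := (P33_pos_two (by omega)).ne'
      have hB : Bden K f ≠ 0 := (Bden_pos_C hK).ne'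
      have hx3 : x3den K f ≠ 0 := by rw [x3den_eq]; exact mul_ne_zero (by norm_num) hB
      field_simp
      simp only [Y33, P33, Bden, Bnum, x3num, x3den, cols1, n33]; ring
  · -- the class `1`: the level-`1` cap-`1` stage
    norm_num
    refine ⟨tab_zero _ _ _ _ _ _, fun c => tab_mem c, tab_B2 _ _ _ _, ?_⟩
    intro c₁ hcK₁ hc₁ hguard₁
    interval_cases c₁
    · -- (M0): `R − 1/3 = (1 − B)(f − 1)/2 + 3(1 − B)·y₁·(K − 1)`
      have hK : 1 ≤ K := hcK
      have hK0 : K ≠ 0 := by omega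
      have hf : 1 ≤ f := by omega
      simp only [tab_zero, tab_top2]
      norm_num
      rw [Nat.cast_sub hf, Nat.cast_sub hK]
      rcases Nat.lt_or_ge K 2 with hK1 | hK2
      · -- `K = 1`: the level-`1` stage has count `0`
        obtain rfl : K = 1 := by omega
        simp only [Nat.sub_self, tab_K0, forced]
        norm_num
        rw [tab_top1 hK0]
        push_cast
        rcases Nat.lt_or_ge f 2 with hf1 | hf2
        · obtain rfl : f = 1 := by omega
          norm_num [Bden, P33, cols1, n33, Y33]
        · have hB : Bden 1 f ≠ 0 := (Bden_pos_A (le_refl 1) hf2).ne'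
          have hP : P33 1 f ≠ 0 := (P33_pos (le_refl 1) (by omega)).ne'
          field_simp
          simp only [Y33, P33, Bden, Bnum, cols1, n33]; ring
      · have hK10 : K - 1 ≠ 0 := by omega
        rw [tab_B1 hK10, tab_top1 hK0]
        have hK1 : ((K - 1 : ℕ) : ℚ) + 1 = K := by rw [Nat.cast_sub hK]; ring
        rw [hK1]
        have hB : Bden K f ≠ 0 := (Bden_pos_B hK2 hf).ne'
        have hP : P33 K f ≠ 0 := (P33_pos_two hK2).ne'
        have ha : anum K f ≠ 0 := (anum_pos_B hK2 hf).ne'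
        have hy : y1den K f ≠ 0 := by simp only [y1den]; exact mul_ne_zero (by norm_num) ha
        field_simp
        simp only [Y33, P33, Bden, Bnum, y1num, y1den, anum, cols1, n33]; ring
    · -- (M1): `R − 5/6 = (1 − B)(1 − y₁)·f + (3/2)(1 − B)(K − 2)`
      have hK : 2 ≤ K := by omega
      have hK0 : K ≠ 0 := by omega
      have hK10 : K - 1 ≠ 0 := by omega
      simp only [tab_top2]
      norm_num
      rw [tab_B2, tab_B1 hK10, tab_top1 hK0]
      have hK1 : ((K - 1 : ℕ) : ℚ) + 1 = K := by rw [Nat.cast_sub (by omega : 1 ≤ K)]; ring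
      have hK2 : ((K - 1 - 1 : ℕ) : ℚ) = K - 2 := by
        rw [Nat.sub_sub, Nat.cast_sub hK]; push_cast; ring
      rw [hK1, hK2]
      rcases Nat.eq_zero_or_pos f with hf0 | hfpos
      · subst hf0
        rcases Nat.lt_or_ge K 3 with hK3 | hK3
        · obtain rfl : K = 2 := by omega
          norm_num [Bden, P33, cols1, n33, Y33, y1den, anum]
        · have hB : Bden K 0 ≠ 0 := (Bden_pos_C hK3).ne'
          have hP : P33 K 0 ≠ 0 := (P33_pos_two hK).ne'
          have ha : anum K 0 ≠ 0 := (anum_pos_C hK3).ne'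
          have hy : y1den K 0 ≠ 0 := by simp only [y1den]; exact mul_ne_zero (by norm_num) ha
          push_cast
          field_simp
          simp only [Y33, P33, Bden, Bnum, y1num, y1den, anum, cols1, n33]; ring
      · have hB : Bden K f ≠ 0 := (Bden_pos_B hK hfpos).ne'
        have hP : P33 K f ≠ 0 := (P33_pos_two hK).ne'
        have ha : anum K f ≠ 0 := (anum_pos_B hK hfpos).ne'
        have hy : y1den K f ≠ 0 := by simp only [y1den]; exact mul_ne_zero (by norm_num) ha
        field_simp
        simp only [Y33, P33, Bden, Bnum, y1num, y1den, anum, cols1, n33]; ring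

/-- **(SP) FOR EVERY FAMILY OF PAIRWISE DISJOINT TRIPLES AT LEVEL `3`, BY THE VALUE-BLOCK PIPELINE** (the first
depth-`2` certificate uniform in `(n, k)`). -/
theorem puncturedNMP_triples33 {α : Type} [Fintype α] [DecidableEq α] {k : ℕ} (C : Fin k → Finset α)
    (hcard : ∀ i, (C i).card = 3) (hdisj : ∀ i j, i ≠ j → Disjoint (C i) (C j)) :
    PuncturedNMP 3 ((univ : Finset (Fin k)).biUnion (fun i => upLevel 3 (C i))) :=
  puncturedNMP_of_countOKg tab C (by norm_num) hcard hdisj (by norm_num)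
    (countOKg_tab k (Fintype.card α - 3 * k))

end PercRepro.PuncturedLYM.Split.Peel.Cap33
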